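import Literature.AlgebraicGeometry.Frobenioids.ArithmeticFrobenioidThm64ivNormPreservation
import HarnessLib

/-!
# Frobenioids I, Thm. 6.4 (iv) at the constructions: the place bijections of `Ψ^Φ_X` are EQUIVARIANT
# under `Aut_{D₁}(X)` — naturality of the Cor. 4.11 (iv) datum, unwound at the arithmetic Frobenioids

Mochizuki, *The geometry of Frobenioids I: the general theory*, Kyushu J. Math. **62** (2008) 293–400, §6,
Ex. 6.3 p. 113 ("functorial": `Φ` is a functor on `D`, arrows acting by pull-back of arithmetic divisors) and
Thm. 6.4 (iv) p. 116 with Cor. 4.11 (iii)/(iv) p. 92 (`Ψ^Φ : Φ₁ ⥲ Φ₂` is an isomorphism of FUNCTORS lying over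
`Ψ^Base`) [cite: MochizukiFrdI2008, Thm. 6.4 (iv) p.116].

PROOF-ONLY file (cell abc-iut, GAP-LEDGER row G-L1t3-1 #2; seat abc-iut-w4-d090, piece (R4) of abc-iut-L1-d3's
archimedean-rigidity programme for the non-Galois clause of Thm. 6.4 (iv)).  For the Cor. 4.11 (iv) datum
`E : DivisorMonoidIsoOverBase (arithFrobenioidOps F₁ K₁) (arithFrobenioidOps F₂ K₂) Ψ^Base` — a family of monoid
isomorphisms `Ψ^Φ_X : Φ(X.L) ⥲ Φ((Ψ^Base X).L)` NATURAL for pull-backs — and the decomposition of `Ψ^Φ_X` into a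
bijection `π` of finite places (generator to generator), a bijection `θ` of infinite places and scalings `c_v > 0`
(`EffArithDivisor.exists_decomposition_monomial_mulEquiv`), naturality at an automorphism `h ∈ Aut_{D₁}(X)` says:
* `arith_finitePlaceEquiv_equivariant` — `π (h^{-1}·w) = (Ψ^Base h)^{-1}·(π w)`, in the tree's vocabulary
  `π (underPlace h w) = underPlace (Ψ^Base h) (π w)`;
* `arith_infinitePlaceEquiv_equivariant` — `θ (v ∘ h) = (θ v) ∘ (Ψ^Base h)` (`InfinitePlace.comap`), valid for
  every endomorphism `h : X ⟶ X`, and the scalings are constant along it: `c (v ∘ h) = c v`.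
Supporting book-keeping: `arith_pull_toAdd` (the pull-back of `C_{K/F}` on `Φ(Spec L) = Multiplicative (EffArithDivisor L)`
IS `EffArithDivisor.pullback`, by `rfl`), and for a ring map with a two-sided inverse: ramification index `1`,
`underPlace` a bijection, `δ_w ↦ δ_{σ⁻¹ w}`, `(0, t) ↦ (0, t ∘ comap)`.
No definitions, no named facts; nothing here bears on [IUTchIII] Cor. 3.12 or asserts anything about abc.
-/

noncomputable section

namespace Literature.AlgebraicGeometry.Frobenioids

open CategoryTheory NumberField ArithPullback

/-! ### Pull-back along a ring map with a two-sided inverse -/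

section Inverse

variable {M : Type*} [Field M] [NumberField M] {L : Type*} [Field L] [NumberField L]

/-- Along a ring map `σ` with a two-sided inverse the ramification indices are `1`.
[cite: MochizukiFrdI2008, Ex. 6.3 p.113] -/
theorem ramIdxPlace_eq_one_of_inverse (σ : M →+* L) (τ : L →+* M) (h₂ : σ.comp τ = RingHom.id L)
    (w : FinitePlace L) : ramIdxPlace σ w = 1 := by
  have h := ramIdxPlace_comp τ σ w
  rw [h₂, ramIdxPlace_id] at h
  exact Nat.eq_one_of_mul_eq_one_left h.symm

/-- Along a ring map `σ` with a two-sided inverse `τ`, `underPlace σ ∘ underPlace τ = id`.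
[cite: MochizukiFrdI2008, Ex. 6.3 p.113] -/
theorem underPlace_underPlace_of_inverse (σ : M →+* L) (τ : L →+* M) (h₁ : τ.comp σ = RingHom.id M)
    (w : FinitePlace M) : underPlace σ (underPlace τ w) = w := by
  rw [← underPlace_comp, h₁, underPlace_id]

/-- **Pull-back of a finite generator along an isomorphism**: `σ^* δ_w = δ_{τ w}` for the inverse `τ` of `σ`
(`underPlace τ w` is the unique place of `L` over `w` along `σ`, unramified).
[cite: MochizukiFrdI2008, Ex. 6.3 p.113] -/
theorem EffArithDivisor.pullback_single_of_inverse (σ : M →+* L) (τ : L →+* M)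
    (h₁ : τ.comp σ = RingHom.id M) (h₂ : σ.comp τ = RingHom.id L) (w : FinitePlace M) :
    EffArithDivisor.pullback σ ((Finsupp.single w 1, 0) : EffArithDivisor M) =
      ((Finsupp.single (underPlace τ w) 1, 0) : EffArithDivisor L) := by
  classical
  refine Prod.ext (Finsupp.ext fun w' => ?_) (funext fun v => ?_)
  · rw [EffArithDivisor.pullback_fst, ramIdxPlace_eq_one_of_inverse σ τ h₂, one_mul, Finsupp.single_apply,
      Finsupp.single_apply]
    by_cases hw : w = underPlace σ w'
    · rw [if_pos hw, if_pos (by rw [hw, underPlace_underPlace_of_inverse τ σ h₂])]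
    · rw [if_neg hw, if_neg (fun h => hw (by rw [← h, underPlace_underPlace_of_inverse σ τ h₁]))]
  · rfl

/-- Pull-back of a purely archimedean divisor: `σ^* (0, t) = (0, t ∘ comap σ)`.
[cite: MochizukiFrdI2008, Ex. 6.3 p.113] -/
theorem EffArithDivisor.pullback_arch (σ : M →+* L) (t : InfinitePlace M → NNReal) :
    EffArithDivisor.pullback σ ((0, t) : EffArithDivisor M) =
      ((0, fun v => t (v.comap σ)) : EffArithDivisor L) :=
  Prod.ext (pullFinsupp_zero σ) rfl

end Inverse

/-! ### At `C_{K/F}`: the pull-back of the divisor monoid IS `EffArithDivisor.pullback` -/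

section Arith

variable {F₁ : Type} [Field F₁] [NumberField F₁] {K₁ : Type} [Field K₁] [Algebra F₁ K₁]
variable {F₂ : Type} [Field F₂] [NumberField F₂] {K₂ : Type} [Field K₂] [Algebra F₂ K₂]

/-- The pull-back `f^* : Φ(X) → Φ(Y)` of `C_{K/F}` along `f : Y ⟶ X` (an `F`-algebra map `X.L → Y.L`) is the
pull-back of effective arithmetic divisors along that field map. [cite: MochizukiFrdI2008, Ex. 6.3 p.113] -/
theorem arith_pull_toAdd {X Y : FinSubextCat F₁ K₁} (f : Y ⟶ X) (m : (arithFrobenioidOps F₁ K₁).Mon X) :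
    Multiplicative.toAdd ((arithFrobenioidOps F₁ K₁).pull f m) =
      EffArithDivisor.pullback f.toAlgHom.toRingHom (Multiplicative.toAdd m) := rfl

omit [NumberField F₁] in
/-- For `h ∈ Aut_{D}(X)`: `h.hom` and `h.inv` give mutually inverse ring maps of `X.L`.
[cite: MochizukiFrdI2008, Ex. 6.3 p.113] -/
theorem FinSubextCat.iso_toRingHom_comp {X : FinSubextCat F₁ K₁} (h : X ≅ X) :
    h.hom.toAlgHom.toRingHom.comp h.inv.toAlgHom.toRingHom = RingHom.id X.L :=
  RingHom.ext fun x => congrArg (fun f : X ⟶ X => f.toAlgHom x) h.hom_inv_id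

omit [NumberField F₁] in
/-- The same for `h.inv ∘ h.hom`. [cite: MochizukiFrdI2008, Ex. 6.3 p.113] -/
theorem FinSubextCat.iso_toRingHom_comp' {X : FinSubextCat F₁ K₁} (h : X ≅ X) :
    h.inv.toAlgHom.toRingHom.comp h.hom.toAlgHom.toRingHom = RingHom.id X.L :=
  RingHom.ext fun x => congrArg (fun f : X ⟶ X => f.toAlgHom x) h.inv_hom_id

/-! ### Equivariance of the place bijections of `Ψ^Φ_X` under `Aut_{D₁}(X)` -/

/-- **Finite places: `π` is `Aut_{D₁}(X)`-equivariant.**  For the Cor. 4.11 (iv) datum `E = Ψ^Φ` (natural for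
pull-backs) and its generator-to-generator bijection `π_X` at `X`, and `h ∈ Aut_{D₁}(X)` (so `Ψ^Base h ∈
Aut_{D₂}(Ψ^Base X)`): `π (underPlace h w) = underPlace (Ψ^Base h) (π w)` — i.e. `π ∘ h^* = (Ψ^Base h)^* ∘ π` on finite
places (naturality of `Ψ^Φ` evaluated at the generator `δ_w`). [cite: MochizukiFrdI2008, Thm. 6.4 (iv) p.116] -/
theorem arith_finitePlaceEquiv_equivariant {ΨBase : FinSubextCat F₁ K₁ ⥤ FinSubextCat F₂ K₂}
    (E : PreFrobenioidData.DivisorMonoidIsoOverBase (arithFrobenioidOps F₁ K₁) (arithFrobenioidOps F₂ K₂) ΨBase)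
    (X : FinSubextCat F₁ K₁) (π : FinitePlace X.L → FinitePlace (ΨBase.obj X).L)
    (hπ : ∀ w : FinitePlace X.L,
      E.iso X (Multiplicative.ofAdd (EffArithDivisor.single X.L (Sum.inr w))) =
        Multiplicative.ofAdd (EffArithDivisor.single (ΨBase.obj X).L (Sum.inr (π w))))
    (h : X ≅ X) (w : FinitePlace X.L) :
    π (underPlace h.hom.toAlgHom.toRingHom w) = underPlace (ΨBase.map h.hom).toAlgHom.toRingHom (π w) := by
  -- the inverse pairs downstairs and upstairs
  have h₁ := FinSubextCat.iso_toRingHom_comp h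
  have h₂ := FinSubextCat.iso_toRingHom_comp' h
  have g₁ := FinSubextCat.iso_toRingHom_comp (ΨBase.mapIso h)
  have g₂ := FinSubextCat.iso_toRingHom_comp' (ΨBase.mapIso h)
  rw [Functor.mapIso_hom, Functor.mapIso_inv] at g₁ g₂
  -- `Ψ^Φ_X` on `EffArithDivisor`, concretely
  let eE : EffArithDivisor X.L →+ EffArithDivisor (ΨBase.obj X).L :=
    AddMonoidHom.toMultiplicative.symm (E.iso X).toMonoidHom
  have heE : ∀ D, eE D = Multiplicative.toAdd (E.iso X (Multiplicative.ofAdd D)) := fun D => rfl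
  have hgen : ∀ w' : FinitePlace X.L, eE (Finsupp.single w' 1, 0) = (Finsupp.single (π w') 1, 0) :=
    fun w' => by
    rw [heE, ← EffArithDivisor.single_inr X.L w']
    change Multiplicative.toAdd (E.iso X (Multiplicative.ofAdd (EffArithDivisor.single X.L (Sum.inr w')))) = _
    rw [hπ]
    rfl
  -- naturality of `Ψ^Φ` for the pull-back along `h.inv`, concretely
  have hnat : ∀ D : EffArithDivisor X.L, eE (EffArithDivisor.pullback h.inv.toAlgHom.toRingHom D) =
      EffArithDivisor.pullback (ΨBase.map h.inv).toAlgHom.toRingHom (eE D) := fun D =>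
    congrArg Multiplicative.toAdd (E.natural h.inv (Multiplicative.ofAdd D))
  -- evaluated at the generator `δ_w`
  have key := hnat (Finsupp.single w 1, 0)
  rw [EffArithDivisor.pullback_single_of_inverse _ _ h₁ h₂, hgen, hgen,
    EffArithDivisor.pullback_single_of_inverse _ _ g₁ g₂] at key
  exact Finsupp.single_left_injective one_ne_zero (congrArg Prod.fst key)

/-- **Infinite places: `θ` is equivariant and the scalings are constant along `D₁`-endomorphisms.**  For the
Cor. 4.11 (iv) datum `E = Ψ^Φ` and the archimedean decomposition `(Ψ^Φ_X (f, t))(θ v) = c_v · t_v` of `Ψ^Φ_X`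
(`EffArithDivisor.exists_decomposition_monomial_mulEquiv`), and any `h : X ⟶ X` in `D₁`:
`θ (v ∘ h) = (θ v) ∘ (Ψ^Base h)` and `c_{v ∘ h} = c_v` (naturality of `Ψ^Φ` evaluated at the archimedean generator
`(0, δ_{v ∘ h})`). [cite: MochizukiFrdI2008, Thm. 6.4 (iv) p.116] -/
theorem arith_infinitePlaceEquiv_equivariant {ΨBase : FinSubextCat F₁ K₁ ⥤ FinSubextCat F₂ K₂}
    (E : PreFrobenioidData.DivisorMonoidIsoOverBase (arithFrobenioidOps F₁ K₁) (arithFrobenioidOps F₂ K₂) ΨBase)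
    (X : FinSubextCat F₁ K₁) (θ : InfinitePlace X.L ≃ InfinitePlace (ΨBase.obj X).L)
    (c : InfinitePlace X.L → NNReal) (hc : ∀ v, c v ≠ 0)
    (hθ : ∀ (D : EffArithDivisor X.L) (v : InfinitePlace X.L),
      (Multiplicative.toAdd (E.iso X (Multiplicative.ofAdd D))).2 (θ v) = c v * D.2 v)
    (h : X ⟶ X) (v : InfinitePlace X.L) :
    θ (v.comap h.toAlgHom.toRingHom) = (θ v).comap (ΨBase.map h).toAlgHom.toRingHom ∧
      c (v.comap h.toAlgHom.toRingHom) = c v := by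
  classical
  -- `Ψ^Φ_X` on `EffArithDivisor`, concretely
  let eE : EffArithDivisor X.L →+ EffArithDivisor (ΨBase.obj X).L :=
    AddMonoidHom.toMultiplicative.symm (E.iso X).toMonoidHom
  have hθ' : ∀ (D : EffArithDivisor X.L) (v : InfinitePlace X.L), (eE D).2 (θ v) = c v * D.2 v :=
    fun D v => hθ D v
  -- naturality of `Ψ^Φ` for the pull-back along `h`, concretely, at the archimedean generator `(0, δ_{v ∘ h})`
  have hnat : ∀ D : EffArithDivisor X.L, eE (EffArithDivisor.pullback h.toAlgHom.toRingHom D) =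
      EffArithDivisor.pullback (ΨBase.map h).toAlgHom.toRingHom (eE D) := fun D =>
    congrArg Multiplicative.toAdd (E.natural h (Multiplicative.ofAdd D))
  have key0 := hnat (0, Pi.single (v.comap h.toAlgHom.toRingHom) 1)
  rw [EffArithDivisor.pullback_arch] at key0
  have key := congrArg (fun D : EffArithDivisor (ΨBase.obj X).L => D.2 (θ v)) key0
  simp only [EffArithDivisor.pullback_snd] at key
  obtain ⟨u, hu⟩ := θ.surjective ((θ v).comap (ΨBase.map h).toAlgHom.toRingHom)
  rw [← hu, hθ', hθ'] at key
  dsimp only at key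
  rw [Pi.single_eq_same, mul_one] at key
  by_cases huv : u = v.comap h.toAlgHom.toRingHom
  · subst huv
    rw [Pi.single_eq_same, mul_one] at key
    exact ⟨hu, key.symm⟩
  · rw [Pi.single_eq_of_ne huv, mul_zero] at key
    exact absurd key (hc v)

/-- Corollary for `h ∈ Aut_{D₁}(X)`: `θ ∘ h^* = (Ψ^Base h)^* ∘ θ` on infinite places, stated for the iso `h`.
[cite: MochizukiFrdI2008, Thm. 6.4 (iv) p.116] -/
theorem arith_infinitePlaceEquiv_equivariant_iso {ΨBase : FinSubextCat F₁ K₁ ⥤ FinSubextCat F₂ K₂}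
    (E : PreFrobenioidData.DivisorMonoidIsoOverBase (arithFrobenioidOps F₁ K₁) (arithFrobenioidOps F₂ K₂) ΨBase)
    (X : FinSubextCat F₁ K₁) (θ : InfinitePlace X.L ≃ InfinitePlace (ΨBase.obj X).L)
    (c : InfinitePlace X.L → NNReal) (hc : ∀ v, c v ≠ 0)
    (hθ : ∀ (D : EffArithDivisor X.L) (v : InfinitePlace X.L),
      (Multiplicative.toAdd (E.iso X (Multiplicative.ofAdd D))).2 (θ v) = c v * D.2 v)
    (h : X ≅ X) (v : InfinitePlace X.L) :
    θ (v.comap h.hom.toAlgHom.toRingHom) = (θ v).comap (ΨBase.map h.hom).toAlgHom.toRingHom :=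
  (arith_infinitePlaceEquiv_equivariant E X θ c hc hθ h.hom v).1

end Arith

end Literature.AlgebraicGeometry.Frobenioids

end
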